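import Literature.NumberTheory.NumberFields.DiscriminantSquareRoot
import Literature.NumberTheory.NumberFields.GaloisClosureDiscriminant
import Literature.NumberTheory.QuadraticFields.ThreeTorsion
import Literature.NumberTheory.QuadraticFields.FundamentalDiscriminantResolvent
import Literature.NumberTheory.GaloisRepresentations.GlobalArtinMapGaloisEquivarianceProofs
import Mathlib.FieldTheory.Normal.Closure
import Mathlib.GroupTheory.Sylow
import HarnessLib

/-!
# The `S₃`-closure of a cubic field over its quadratic resolvent field, inside `k̄`

`Proofs` file (theorems only: no definitions, no named facts). Topic `Literature/NumberTheory/CubicFields`.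
First step of the class-field-theoretic half of Belabas–Bhargava–Pomerance 2010, Lemma 3.3 (after
Hasse 1930 and Davenport–Heilbronn 1971, §6): a cubic field `K` whose discriminant is `d_K = d_k f²` for a
quadratic field `k` (its quadratic resolvent field) determines a cyclic cubic extension `L = K·k` of `k`,
Galois over `ℚ` with group `S₃`, in which the non-trivial automorphism of `k` acts on `Gal(L/k)` by
inversion (Hasse: "die zu `K` gehörige zyklische kubische Erweiterung von `k = ℚ(√d)`"; Davenport–Heilbronn
1971, §6: "`K₆ = K₃(√d)` is normal over `ℚ` with group `S₃`, and cyclic of degree `3` over `K₂ = ℚ(√d)`").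
Everything is built INSIDE `k̄ = AlgebraicClosure k` as an `IntermediateField k k̄`, the habitat of the
tree's global class field theory (`charHecke`, `galFrob`, Bauer's theorem).

For a quadratic number field `k`, a cubic number field `K` with `discr K = discr k · f²`, `f ≠ 0`:
* `not_isGalois_of_discr_eq_mul_sq` — `K/ℚ` is not Galois (`√d_K ∉ ℚ`, while in a cyclic cubic field
  `√d_K` is fixed by the group of odd order `3`);
* `dvd_discr_of_dvd_discr_of_iSup_fieldRange_eq_top` — a prime dividing `d_L` divides `d_K` when the
  Galois field `L` is generated by the conjugates of `K` (the tree's `natAbs_discr_dvd_prod_pow_of_isGalois`),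
  and `isUnramifiedIn_of_intCast_not_mem` — a prime `v ∌ d` of `k` is unramified in `L/k` once every prime
  factor of `d_L` divides `d` (Dedekind's criterion `not_dvd_discr_iff_isUnramifiedIn` + tower top);
* `nonempty_algEquiv_of_algHom_of_finrank_eq_six` — two cubic fields embedded in one sextic Galois field
  are isomorphic (their fixing subgroups are Sylow `2`-subgroups, hence conjugate);
* **`exists_resolventClosure`** — there is `L ⊆ k̄`, abelian of degree `3` over `k`, Galois of degree `6`
  over `ℚ`, receiving a `ℚ`-embedding of `K`, and generated over `ℚ` by the conjugates of `K` (it is the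
  normal closure of `K` over `ℚ` in `k̄`, which contains `k = ℚ(√d_K)`);
* `exists_restrictNormal_ne_one`, **`conjRestrict_eq_inv`**, `sq_eq_one_of_restrictNormal_ne_one` — some
  `τ ∈ Gal(L/ℚ)` is non-trivial on `k`; every such `τ` acts on `Gal(L/k)` by inversion and is an
  involution (the group of order `6` is not abelian, as its subgroup fixing `K` is not normal): `Gal(L/ℚ) ≅ S₃`.

## References

* H. Hasse, *Arithmetische Theorie der kubischen Zahlkörper auf klassenkörpertheoretischer Grundlage*,
  Math. Z. 31 (1930) 565–582 [Hasse1930].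
* H. Davenport, H. Heilbronn, *On the density of discriminants of cubic fields. II*, Proc. Roy. Soc.
  London A 322 (1971) 405–420, §6 [DavenportHeilbronn1971].
* K. Belabas, M. Bhargava, C. Pomerance, *Error estimates for the Davenport–Heilbronn theorems*, Duke
  Math. J. 153 (2010) 173–210, Lemma 3.3 [BelabasBhargavaPomerance2010].
-/

noncomputable section

open NumberField Module IntermediateField IsDedekindDomain
open scoped Pointwise

namespace Literature.NumberTheory.CubicFields

open Literature.NumberTheory.NumberFields Literature.NumberTheory.QuadraticFields
  Literature.NumberTheory.GaloisRepresentations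

universe u

/-! ### A cubic field with discriminant `d_k f²` is not Galois -/

/-- **A cubic field whose discriminant is a fundamental discriminant times a square is not Galois over
`ℚ`**: in a Galois cubic field `√d_K` is fixed by the whole group (odd order `3`), so `d_K` would be a
rational square, while `d_k` is not (`ne_sq_of_isFundamental`). [folklore] -/
theorem not_isGalois_of_discr_eq_mul_sq {k : Type*} [Field k] [NumberField k] (hk : finrank ℚ k = 2)
    (K : Type*) [Field K] [NumberField K] (hK : finrank ℚ K = 3) {f : ℤ} (hf : f ≠ 0)
    (hd : discr K = discr k * f ^ 2) : ¬ IsGalois ℚ K := by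
  intro hG
  classical
  have hcard : Fintype.card (K →ₐ[ℚ] K) = finrank ℚ K := by
    rw [← Nat.card_eq_fintype_card, ← Nat.card_congr (algEquivEquivAlgHom ℚ K).toEquiv,
      IsGalois.card_aut_eq_finrank]
  have hodd : Odd (Nat.card (⊤ : Subgroup (K ≃ₐ[ℚ] K))) := by
    rw [Subgroup.card_top, IsGalois.card_aut_eq_finrank, hK]
    exact ⟨1, rfl⟩
  obtain ⟨δ, hδmem, -, hδsq⟩ := exists_sq_eq_discr_mem_fixedField K K hcard ⊤ hodd
  rw [IsGalois.fixedField_top, IntermediateField.mem_bot] at hδmem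
  obtain ⟨q, rfl⟩ := hδmem
  have hq : (q : ℚ) ^ 2 = (discr K : ℚ) := by
    apply (algebraMap ℚ K).injective
    rw [map_pow, hδsq]
    simp
  have hfq : (f : ℚ) ≠ 0 := by exact_mod_cast hf
  refine Quadratic.ne_sq_of_isFundamental (Quadratic.isFundamentalDiscriminant_discr hk) (q / f) ?_
  rw [div_pow, eq_div_iff (pow_ne_zero 2 hfq), hq, hd]
  push_cast
  ring

/-! ### Discriminant and ramification of a Galois field generated by conjugates of `K` -/

/-- **A prime dividing `d_L` divides `d_K`** when the Galois number field `L` is generated by the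
conjugates of `K`: `|d_L| ∣ ∏_σ |d_{σK}|^{[L:σK]}` (the tree's `natAbs_discr_dvd_prod_pow_of_isGalois`,
the family `(σK)_σ` separating `Gal(L/ℚ)` because it generates `L`) and `d_{σK} = d_K`. For the
`S₃`-closure: `d_L ∣ d_K⁶`, so `L` is unramified at every `p ∤ d_K`. [folklore] -/
theorem dvd_discr_of_dvd_discr_of_iSup_fieldRange_eq_top (K : Type*) [Field K] [NumberField K]
    (L : Type*) [Field L] [NumberField L] [IsGalois ℚ L]
    (hgen : (⨆ σ : K →ₐ[ℚ] L, σ.fieldRange) = ⊤) {p : ℕ} (hp : p.Prime)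
    (hpL : (p : ℤ) ∣ discr L) : (p : ℤ) ∣ discr K := by
  classical
  have hsep : ∀ s : L ≃ₐ[ℚ] L, s ≠ 1 →
      ∃ σ ∈ (Finset.univ : Finset (K →ₐ[ℚ] L)), s ∉ (σ.fieldRange).fixingSubgroup := by
    intro s hs
    by_contra h
    push Not at h
    refine hs (algEquiv_eq_one_of_forall_comp_eq hgen fun σ => ?_)
    ext x
    have hσ := h σ (Finset.mem_univ σ)
    rw [IntermediateField.mem_fixingSubgroup_iff] at hσ
    exact hσ (σ x) ⟨x, rfl⟩
  have h := natAbs_discr_dvd_prod_pow_of_isGalois L Finset.univ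
    (fun σ : K →ₐ[ℚ] L => σ.fieldRange) hsep
  have hfac : ∀ σ : K →ₐ[ℚ] L, (discr σ.fieldRange).natAbs = (discr K).natAbs := fun σ => by
    have e : K ≃ₐ[ℚ] σ.fieldRange := AlgEquiv.ofInjectiveField σ
    rw [NumberField.discr_eq_discr_of_algEquiv K e]
  simp only [hfac, Finset.prod_pow_eq_pow_sum] at h
  have hpL' : p ∣ (discr L).natAbs := by
    rwa [← Int.natCast_dvd_natCast, Int.dvd_natAbs]
  have hpK : p ∣ (discr K).natAbs := hp.dvd_of_dvd_pow (hpL'.trans h)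
  rwa [← Int.natCast_dvd_natCast, Int.dvd_natAbs] at hpK

/-- **Unramified primes of the base from the discriminant**: for number fields `k ⊆ L` and an integer
`d` divisible by every prime factor of `d_L`, every prime `v` of `k` not containing `d` is unramified
in `L/k` (its residue characteristic `p` does not divide `d_L`, so `p` is unramified in `L/ℚ` —
Mathlib's Dedekind criterion `not_dvd_discr_iff_isUnramifiedIn` — and unramifiedness passes to the top
of the tower `ℤ ⊆ 𝓞_k ⊆ 𝓞_L`). [folklore] -/
theorem isUnramifiedIn_of_intCast_not_mem {k : Type*} [Field k] [NumberField k] (L : Type*) [Field L]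
    [NumberField L] [Algebra k L] {d : ℤ}
    (hdL : ∀ p : ℕ, p.Prime → (p : ℤ) ∣ discr L → (p : ℤ) ∣ d)
    (v : HeightOneSpectrum (𝓞 k)) (hv : ((d : 𝓞 k)) ∉ v.asIdeal) :
    Algebra.IsUnramifiedIn (𝓞 L) v.asIdeal := by
  classical
  haveI := v.isPrime
  haveI : NeZero v.asIdeal := ⟨v.ne_bot⟩
  set p : ℕ := Ideal.absNorm (v.asIdeal.under ℤ) with hpdef
  have hp : p.Prime := Nat.absNorm_under_prime v.asIdeal
  have hpd : ¬ (p : ℤ) ∣ d := fun h => hv (Int.cast_mem_ideal_iff.mpr h)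
  have hpL : ¬ (p : ℤ) ∣ discr L := fun h => hpd (hdL p hp h)
  have hunrZ : Algebra.IsUnramifiedIn (𝓞 L) (Ideal.span {(p : ℤ)}) :=
    (NumberField.not_dvd_discr_iff_isUnramifiedIn L (𝓞 L) (Nat.prime_iff_prime_int.mp hp)).mp hpL
  rw [Algebra.isUnramifiedIn_iff_forall_of_isDedekindDomain]
  intro P hP hPv
  haveI := hP
  haveI := hPv
  haveI : P.LiesOver (Ideal.span {(p : ℤ)}) :=
    Ideal.LiesOver.trans P v.asIdeal (Ideal.span {(p : ℤ)})
  haveI hZ : Algebra.IsUnramifiedAt ℤ P :=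
    (Algebra.isUnramifiedIn_iff_forall_of_isDedekindDomain.mp hunrZ) P hP inferInstance
  exact Algebra.IsUnramifiedAt.of_restrictScalars ℤ P

/-- In a sextic Galois number field, the subgroup fixing a cubic subfield has order `2`. [folklore] -/
theorem card_fixingSubgroup_fieldRange_eq_two (L : Type*) [Field L] [NumberField L] [IsGalois ℚ L]
    (hL : finrank ℚ L = 6) {K : Type*} [Field K] [NumberField K] (hK : finrank ℚ K = 3)
    (ι : K →ₐ[ℚ] L) : Nat.card (ι.fieldRange.fixingSubgroup) = 2 := by
  rw [IsGalois.card_fixingSubgroup_eq_finrank]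
  have hKF : finrank ℚ ι.fieldRange = 3 := by
    rw [← hK]
    exact (LinearEquiv.finrank_eq (AlgEquiv.ofInjectiveField ι).toLinearEquiv).symm
  have := Module.finrank_mul_finrank ℚ ι.fieldRange L
  rw [hKF, hL] at this
  omega

/-- **Two cubic fields inside one sextic Galois field are isomorphic**: their fixing subgroups have
order `6/3 = 2`, are Sylow `2`-subgroups of `Gal(L/ℚ)`, hence conjugate, `g H₁ g⁻¹ = H₂`; by the Galois
correspondence `g(K₁) = K₂`. (For the `S₃`-closure this is "the three cubic subfields of `K₆` are
conjugate", Hasse 1930.) [folklore] -/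
theorem nonempty_algEquiv_of_algHom_of_finrank_eq_six (L : Type*) [Field L] [NumberField L]
    [IsGalois ℚ L] (hL : finrank ℚ L = 6)
    {K₁ : Type*} [Field K₁] [NumberField K₁] (h₁ : finrank ℚ K₁ = 3) (ι₁ : K₁ →ₐ[ℚ] L)
    {K₂ : Type*} [Field K₂] [NumberField K₂] (h₂ : finrank ℚ K₂ = 3) (ι₂ : K₂ →ₐ[ℚ] L) :
    Nonempty (K₁ ≃ₐ[ℚ] K₂) := by
  classical
  haveI : Fact (Nat.Prime 2) := ⟨Nat.prime_two⟩
  have hG : Nat.card (L ≃ₐ[ℚ] L) = 6 := by rw [IsGalois.card_aut_eq_finrank, hL]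
  have hfac : (Nat.card (L ≃ₐ[ℚ] L)).factorization 2 = 1 := by
    rw [hG, show (6 : ℕ) = 2 * 3 from rfl, Nat.factorization_mul two_ne_zero three_ne_zero,
      Finsupp.add_apply, Nat.Prime.factorization_self Nat.prime_two,
      Nat.factorization_eq_zero_of_not_dvd (by norm_num : ¬ 2 ∣ 3)]
  -- the fixing subgroups of the cubic subfields have order `2 = 2 ^ v₂(6)`: Sylow `2`-subgroups
  have hc₁ : Nat.card (ι₁.fieldRange.fixingSubgroup) = 2 ^ (Nat.card (L ≃ₐ[ℚ] L)).factorization 2 := by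
    rw [hfac, pow_one]; exact card_fixingSubgroup_fieldRange_eq_two L hL h₁ ι₁
  have hc₂ : Nat.card (ι₂.fieldRange.fixingSubgroup) = 2 ^ (Nat.card (L ≃ₐ[ℚ] L)).factorization 2 := by
    rw [hfac, pow_one]; exact card_fixingSubgroup_fieldRange_eq_two L hL h₂ ι₂
  set P₁ : Sylow 2 (L ≃ₐ[ℚ] L) := Sylow.ofCard _ hc₁ with hP₁
  set P₂ : Sylow 2 (L ≃ₐ[ℚ] L) := Sylow.ofCard _ hc₂ with hP₂
  obtain ⟨g, hg⟩ := MulAction.exists_smul_eq (L ≃ₐ[ℚ] L) P₁ P₂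
  have hfix : (ι₁.fieldRange.map (g : L →ₐ[ℚ] L)).fixingSubgroup = ι₂.fieldRange.fixingSubgroup := by
    rw [IsGalois.map_fixingSubgroup]
    change MulAut.conj g • (P₁ : Subgroup (L ≃ₐ[ℚ] L)) = (P₂ : Subgroup (L ≃ₐ[ℚ] L))
    rw [← Sylow.coe_subgroup_smul, hg]
  have hfield : ι₁.fieldRange.map (g : L →ₐ[ℚ] L) = ι₂.fieldRange := by
    have := congrArg IntermediateField.fixedField hfix
    rwa [IsGalois.fixedField_fixingSubgroup, IsGalois.fixedField_fixingSubgroup] at this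
  have e₁ : K₁ ≃ₐ[ℚ] ι₁.fieldRange := AlgEquiv.ofInjectiveField ι₁
  have e₂ : K₂ ≃ₐ[ℚ] ι₂.fieldRange := AlgEquiv.ofInjectiveField ι₂
  exact ⟨(e₁.trans ((IntermediateField.equivMap ι₁.fieldRange (g : L →ₐ[ℚ] L)).trans
    (IntermediateField.equivOfEq hfield))).trans e₂.symm⟩

/-! ### The closure inside `k̄` -/

section Closure

variable {k : Type} [Field k] [NumberField k]

/-- `k̄` is an algebraic closure of `ℚ` (algebraic over the number field `k`), hence normal over `ℚ`;
recorded as a lemma producing the instance locally. [folklore] -/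
theorem isAlgClosure_rat_algebraicClosure : IsAlgClosure ℚ (AlgebraicClosure k) :=
  haveI : Algebra.IsAlgebraic ℚ (AlgebraicClosure k) := Algebra.IsAlgebraic.trans ℚ k (AlgebraicClosure k)
  ⟨inferInstance, inferInstance⟩

/-- **The `S₃`-closure `L = K·k ⊆ k̄` of a cubic field `K` over its quadratic resolvent field `k`.**
For a quadratic number field `k` and a cubic number field `K` with `discr K = discr k · f²` (`f ≠ 0`) there is
an intermediate field `L` of `k̄/k` which is finite abelian (Galois with commutative group) of degree `3` over
`k`, Galois of degree `6` over `ℚ`, receives a `ℚ`-embedding of `K`, and is generated over `ℚ` by the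
images of the embeddings `K → L` (Davenport–Heilbronn 1971, §6: `K₆ = K₃ K₂` normal over `ℚ`, cyclic cubic
over `K₂ = ℚ(√d)`; Hasse 1930). Construction: the normal closure `N` of `K/ℚ` in `k̄` contains
`√d_K = f√d_k`, hence `k`; `L = k·N = N`; `[N : ℚ] ≤ 3! = 6` (faithful action on the three embeddings) and
`6 ∣ [N : ℚ]` (`3 = [K:ℚ]` and `2 = [k:ℚ]` divide it). [cite: DavenportHeilbronn1971, §6 (K₆ = K₃(√d), S₃ over ℚ, cyclic over K₂)] -/
theorem exists_resolventClosure (hk : finrank ℚ k = 2) (K : Type) [Field K] [NumberField K]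
    (hK : finrank ℚ K = 3) {f : ℤ} (hf : f ≠ 0) (hd : discr K = discr k * f ^ 2) :
    ∃ L : IntermediateField k (AlgebraicClosure k), ∃ _ : FiniteDimensional k L,
      finrank k L = 3 ∧ IsAbelianGalois k L ∧ IsGalois ℚ L ∧ finrank ℚ L = 6 ∧
      Nonempty (K →ₐ[ℚ] L) ∧ (⨆ σ : K →ₐ[ℚ] L, σ.fieldRange) = ⊤ := by
  classical
  set Ω := AlgebraicClosure k with hΩ
  haveI : CharZero Ω := charZero_of_injective_algebraMap (algebraMap k Ω).injective
  haveI hIAC : IsAlgClosure ℚ Ω := isAlgClosure_rat_algebraicClosure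
  haveI : Algebra.IsAlgebraic ℚ Ω := hIAC.isAlgebraic
  haveI : Normal ℚ Ω := IsAlgClosure.normal ℚ Ω
  -- an embedding of `K` and the normal closure `N`
  set ι₀ : K →ₐ[ℚ] Ω := IsAlgClosed.lift with hι₀
  haveI : Nonempty (K →ₐ[ℚ] Ω) := ⟨ι₀⟩
  set N : IntermediateField ℚ Ω := normalClosure ℚ K Ω with hNdef
  haveI : FiniteDimensional ℚ N := normalClosure.is_finiteDimensional ℚ K Ω
  haveI : Normal ℚ N := normalClosure.normal ℚ K Ω
  haveI : Algebra.IsSeparable ℚ N := Algebra.IsAlgebraic.isSeparable_of_perfectField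
  haveI : IsGalois ℚ N := IsGalois.mk
  set ι : K →ₐ[ℚ] N := (normalClosure.algHomEquiv ℚ K Ω).symm ι₀ with hιdef
  -- the embeddings of `K` into `N` are all the embeddings into `Ω`: there are `3` of them
  have hcard : Fintype.card (K →ₐ[ℚ] N) = finrank ℚ K :=
    (Fintype.card_congr (normalClosure.algHomEquiv ℚ K Ω)).trans (AlgHom.card ℚ K Ω)
  -- the conjugates of `K` generate `N`
  have hgen : (⨆ σ : K →ₐ[ℚ] N, σ.fieldRange) = ⊤ := by
    have h := (Algebra.IsAlgebraic.isNormalClosure_iff.mp (isNormalClosure_normalClosure ℚ K Ω)).2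
    rwa [normalClosure_def] at h
  -- `√d_K ∈ N`
  obtain ⟨δ, hδsq, -⟩ := exists_det_sq_eq_discr K N hcard
  have hδΩ : ((δ : N) : Ω) ^ 2 = ((discr K : ℤ) : Ω) := by
    have := congrArg (fun x : N => (x : Ω)) hδsq
    simpa using this
  -- a square root `s` of `d_k` generating `k`
  obtain ⟨s, hs, hssq⟩ := Quadratic.exists_not_mem_range_sq_eq_discr hk
  have hsΩ : (algebraMap k Ω s) ^ 2 = ((discr k : ℤ) : Ω) := by
    rw [← map_pow, hssq, ← IsScalarTower.algebraMap_apply ℚ k Ω, map_intCast]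
  -- `f · s = ± δ`, so `s ∈ N`
  have hfΩ : ((f : ℤ) : Ω) ≠ 0 := by exact_mod_cast hf
  have hsN : algebraMap k Ω s ∈ N := by
    have h1 : (((f : ℤ) : Ω) * algebraMap k Ω s) ^ 2 = ((δ : N) : Ω) ^ 2 := by
      rw [mul_pow, hsΩ, hδΩ, hd, Int.cast_mul, Int.cast_pow]
      ring
    have hrew : algebraMap k Ω s = ((f : ℤ) : Ω)⁻¹ * (((f : ℤ) : Ω) * algebraMap k Ω s) := by
      rw [inv_mul_cancel_left₀ hfΩ]
    rw [hrew]
    refine mul_mem (inv_mem (intCast_mem N f)) ?_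
    rcases sq_eq_sq_iff_eq_or_eq_neg.mp h1 with h | h
    · rw [h]; exact δ.2
    · rw [h]; exact neg_mem δ.2
  -- hence `k ⊆ N`
  have hkN : ∀ x : k, algebraMap k Ω x ∈ N := by
    intro x
    obtain ⟨a, b, rfl⟩ := Quadratic.exists_eq_add_mul hk hs x
    rw [map_add, map_mul, ← IsScalarTower.algebraMap_apply, ← IsScalarTower.algebraMap_apply]
    exact add_mem (IntermediateField.algebraMap_mem N a)
      (mul_mem (IntermediateField.algebraMap_mem N b) hsN)
  -- `L = k·N`, with the same carrier as `N`
  set L : IntermediateField k Ω := IntermediateField.adjoin k (N : Set Ω) with hLdef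
  have hmem : ∀ x : Ω, x ∈ L ↔ x ∈ N := by
    intro x
    constructor
    · intro hx
      have hle : (IntermediateField.adjoin k (N : Set Ω)).toSubfield ≤ N.toSubfield := by
        rw [IntermediateField.adjoin_toSubfield]
        refine Subfield.closure_le.mpr (Set.union_subset ?_ fun y hy => hy)
        rintro _ ⟨y, rfl⟩
        exact hkN y
      exact hle hx
    · intro hx
      exact IntermediateField.subset_adjoin k (N : Set Ω) hx
  -- the `ℚ`-algebra isomorphism `e : N ≃ L` (identity on the carrier)
  set e₀ : N ≃+* L :=
    { toFun := fun x => ⟨x.1, (hmem x.1).mpr x.2⟩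
      invFun := fun y => ⟨y.1, (hmem y.1).mp y.2⟩
      left_inv := fun x => rfl
      right_inv := fun y => rfl
      map_mul' := fun x y => rfl
      map_add' := fun x y => rfl } with he₀
  have he₀val : ∀ x : N, ((e₀ x : L) : Ω) = (x : Ω) := fun x => rfl
  set e : N ≃ₐ[ℚ] L := AlgEquiv.ofRingEquiv (f := e₀) (fun q => by
    apply Subtype.ext
    rw [he₀val]
    simp [eq_ratCast]) with hedef
  haveI hLfdQ : FiniteDimensional ℚ L := LinearEquiv.finiteDimensional e.toLinearEquiv
  haveI hLfd : FiniteDimensional k L := Module.Finite.of_restrictScalars_finite ℚ k L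
  have hfinLN : finrank ℚ L = finrank ℚ N := (LinearEquiv.finrank_eq e.toLinearEquiv).symm
  -- degrees: `3 ∣ [N:ℚ]`, `2 ∣ [N:ℚ]`, `[N:ℚ] ≤ 6`
  have h3dvd : 3 ∣ finrank ℚ N := by
    have hKF : finrank ℚ ι.fieldRange = 3 := by
      rw [← hK]
      exact (LinearEquiv.finrank_eq (AlgEquiv.ofInjectiveField ι).toLinearEquiv).symm
    exact ⟨finrank ι.fieldRange N, by rw [← hKF, Module.finrank_mul_finrank]⟩
  have h2dvd : 2 ∣ finrank ℚ N := by
    refine ⟨finrank k L, ?_⟩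
    rw [← hfinLN, ← hk, Module.finrank_mul_finrank]
  have hle6 : finrank ℚ N ≤ 6 := by
    obtain ⟨-, ρ, -, hρ, -⟩ := exists_perm_hom_det_sq_eq_discr K N hcard
    have hρinj : Function.Injective ρ := by
      rw [← MonoidHom.ker_eq_bot_iff, Subgroup.eq_bot_iff_forall]
      intro τ hτ
      rw [MonoidHom.mem_ker] at hτ
      refine algEquiv_eq_one_of_forall_comp_eq hgen fun σ => ?_
      have := congrArg (fun π => π σ) hτ
      simpa [hρ] using this
    calc finrank ℚ N = Nat.card (N ≃ₐ[ℚ] N) := (IsGalois.card_aut_eq_finrank ℚ N).symm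
      _ ≤ Nat.card (Equiv.Perm (K →ₐ[ℚ] N)) := Nat.card_le_card_of_injective ρ hρinj
      _ = 6 := by
          rw [Nat.card_eq_fintype_card, Fintype.card_perm, hcard, hK]
          rfl
  have h6 : finrank ℚ N = 6 := by
    have h6dvd : 6 ∣ finrank ℚ N := Nat.Coprime.mul_dvd_of_dvd_of_dvd (by norm_num) h2dvd h3dvd
    have hpos : 0 < finrank ℚ N := finrank_pos
    obtain ⟨c, hc⟩ := h6dvd
    omega
  have hL6 : finrank ℚ L = 6 := hfinLN.trans h6
  have hL3 : finrank k L = 3 := by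
    have := Module.finrank_mul_finrank ℚ k L
    rw [hk, hL6] at this
    omega
  -- Galois structures
  haveI : Normal ℚ L := Normal.of_algEquiv e
  haveI hGalQ : IsGalois ℚ L := IsGalois.of_algEquiv e
  haveI : Normal k L := Normal.tower_top_of_normal ℚ k L
  haveI : Algebra.IsSeparable k L := Algebra.IsAlgebraic.isSeparable_of_perfectField
  haveI hGal : IsGalois k L := IsGalois.mk
  -- the group of order `3` is commutative
  have hcomm : ∀ a b : L ≃ₐ[k] L, a * b = b * a := by
    haveI : Fact (Nat.Prime 3) := ⟨Nat.prime_three⟩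
    have hc3 : Nat.card (L ≃ₐ[k] L) = 3 := by rw [IsGalois.card_aut_eq_finrank, hL3]
    haveI : IsCyclic (L ≃ₐ[k] L) := isCyclic_of_prime_card hc3
    obtain ⟨g, hg⟩ := IsCyclic.exists_generator (α := L ≃ₐ[k] L)
    intro a b
    obtain ⟨m, rfl⟩ := Subgroup.mem_zpowers_iff.mp (hg a)
    obtain ⟨n, rfl⟩ := Subgroup.mem_zpowers_iff.mp (hg b)
    exact zpow_mul_comm g m n
  haveI : IsMulCommutative (L ≃ₐ[k] L) := ⟨⟨hcomm⟩⟩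
  have hAb : IsAbelianGalois k L := ⟨⟩
  -- the conjugates of `K` generate `L`
  have hgenL : (⨆ σ : K →ₐ[ℚ] L, σ.fieldRange) = ⊤ := by
    apply top_le_iff.mp
    have htop : (⊤ : IntermediateField ℚ N).map (e : N →ₐ[ℚ] L) = ⊤ := by
      rw [← AlgHom.fieldRange_eq_map]
      exact AlgEquiv.fieldRange_eq_top e
    calc (⊤ : IntermediateField ℚ L) = (⊤ : IntermediateField ℚ N).map (e : N →ₐ[ℚ] L) := htop.symm
      _ = (⨆ σ : K →ₐ[ℚ] N, σ.fieldRange).map (e : N →ₐ[ℚ] L) := by rw [hgen]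
      _ = ⨆ σ : K →ₐ[ℚ] N, (σ.fieldRange).map (e : N →ₐ[ℚ] L) := IntermediateField.map_iSup _ _
      _ ≤ ⨆ σ : K →ₐ[ℚ] L, σ.fieldRange :=
          iSup_le fun σ => le_iSup_of_le ((e : N →ₐ[ℚ] L).comp σ)
            (le_of_eq (AlgHom.map_fieldRange σ (e : N →ₐ[ℚ] L)))
  exact ⟨L, hLfd, hL3, hAb, hGalQ, hL6, ⟨(e : N →ₐ[ℚ] L).comp ι⟩, hgenL⟩

end Closure

/-! ### The dihedral structure: `Gal(k/ℚ)` acts on `Gal(L/k)` by inversion -/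

section Dihedral

variable {k : Type} [Field k] [NumberField k] [IsGalois ℚ k]
  (L : IntermediateField k (AlgebraicClosure k)) [FiniteDimensional k L] [IsGalois ℚ L]

omit [FiniteDimensional k L] [IsGalois ℚ L] in
/-- An automorphism of `L/ℚ` trivial on `k` is `k`-linear. [folklore] -/
theorem exists_restrictScalars_eq_of_restrictNormal_eq_one {τ : L ≃ₐ[ℚ] L}
    (hτ : τ.restrictNormal k = 1) : ∃ a : L ≃ₐ[k] L, a.restrictScalars ℚ = τ := by
  refine ⟨{ τ with commutes' := fun c => ?_ }, AlgEquiv.ext fun x => rfl⟩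
  change τ (algebraMap k L c) = algebraMap k L c
  have h := AlgEquiv.restrictNormal_commutes τ k c
  rw [hτ, AlgEquiv.one_apply] at h
  exact h.symm

omit [FiniteDimensional k L] in
/-- **Some automorphism of `L/ℚ` is non-trivial on the quadratic field `k`** (restriction to the normal
subfield `k` is onto `Gal(k/ℚ)`, of order `2`). [folklore] -/
theorem exists_restrictNormal_ne_one (hk : finrank ℚ k = 2) :
    ∃ τ : L ≃ₐ[ℚ] L, τ.restrictNormal k ≠ 1 := by
  have hcard : Nat.card (k ≃ₐ[ℚ] k) = 2 := by rw [IsGalois.card_aut_eq_finrank, hk]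
  obtain ⟨σ, hσ⟩ : ∃ σ : k ≃ₐ[ℚ] k, σ ≠ 1 := by
    by_contra h
    push Not at h
    haveI : Subsingleton (k ≃ₐ[ℚ] k) := ⟨fun a b => by rw [h a, h b]⟩
    have := Nat.card_of_subsingleton (1 : k ≃ₐ[ℚ] k)
    omega
  obtain ⟨τ, rfl⟩ := AlgEquiv.restrictNormalHom_surjective L σ
  exact ⟨τ, hσ⟩

/-- **`Gal(k/ℚ)` acts on `Gal(L/k)` by inversion** (Davenport–Heilbronn 1971, §6: `Gal(K₆/ℚ) ≅ S₃`;
Hasse 1930): if `[k : ℚ] = 2`, `[L : k] = 3`, `L/ℚ` is Galois and `L` receives a field `K` that is not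
Galois over `ℚ`, then for every `τ ∈ Gal(L/ℚ)` non-trivial on `k` and every `a ∈ Gal(L/k)`,
`τ a τ⁻¹ = a⁻¹`. Proof: `c = τ(·)τ⁻¹` is an endomorphism of the cyclic group `Gal(L/k)` of prime order
with `c² = id` (`τ²` restricts trivially to `k`, and `Gal(L/k)` is abelian); an element `b ≠ 1` fixed by
`c` would generate `Gal(L/k)`, making `Gal(L/ℚ) = Gal(L/k) ∪ τ·Gal(L/k)` abelian, its subgroup fixing `K`
normal, and `K/ℚ` Galois; so `a · c(a)`, which is fixed by `c`, is trivial.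
[cite: DavenportHeilbronn1971, §6 (Gal(K₆/ℚ) = S₃)] -/
theorem conjRestrict_eq_inv (hk : finrank ℚ k = 2) (h3 : finrank k L = 3)
    {K : Type*} [Field K] [Algebra ℚ K] (hKG : ¬ IsGalois ℚ K) (ι : K →ₐ[ℚ] L)
    {τ : L ≃ₐ[ℚ] L} (hτ : τ.restrictNormal k ≠ 1) (a : L ≃ₐ[k] L) :
    conjRestrict τ a = a⁻¹ := by
  classical
  haveI : Fact (Nat.Prime 3) := ⟨Nat.prime_three⟩
  haveI : FiniteDimensional ℚ L := Module.Finite.trans k L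
  haveI : IsGalois k L := by
    haveI : Normal k L := Normal.tower_top_of_normal ℚ k L
    haveI : Algebra.IsSeparable k L := Algebra.IsAlgebraic.isSeparable_of_perfectField
    exact IsGalois.mk
  have hc3 : Nat.card (L ≃ₐ[k] L) = 3 := by rw [IsGalois.card_aut_eq_finrank, h3]
  haveI : IsCyclic (L ≃ₐ[k] L) := isCyclic_of_prime_card hc3
  have hcommA : ∀ a b : L ≃ₐ[k] L, a * b = b * a := fun a b => by
    obtain ⟨g, hg⟩ := IsCyclic.exists_generator (α := L ≃ₐ[k] L)
    obtain ⟨m, rfl⟩ := Subgroup.mem_zpowers_iff.mp (hg a)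
    obtain ⟨n, rfl⟩ := Subgroup.mem_zpowers_iff.mp (hg b)
    exact zpow_mul_comm g m n
  have hcard2 : Nat.card (k ≃ₐ[ℚ] k) = 2 := by rw [IsGalois.card_aut_eq_finrank, hk]
  -- `τ²` is trivial on `k`: `τ² = a₀` for some `a₀ ∈ Gal(L/k)`
  have hτ2 : (τ ^ 2).restrictNormal k = 1 := by
    change AlgEquiv.restrictNormalHom k (τ ^ 2) = 1
    rw [map_pow, ← hcard2]
    exact pow_card_eq_one'
  obtain ⟨a₀, ha₀⟩ := exists_restrictScalars_eq_of_restrictNormal_eq_one L hτ2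
  -- the conjugation endomorphism `c` and `c ∘ c = id`
  set c : (L ≃ₐ[k] L) →* (L ≃ₐ[k] L) := conjRestrictHom τ with hcdef
  have h1 : ∀ y : L, τ (τ y) = a₀ y := fun y => by
    rw [← AlgEquiv.mul_apply, ← sq, ← ha₀]; rfl
  have h2 : ∀ y : L, τ.symm (τ.symm y) = a₀.symm y := fun y => by
    apply a₀.injective
    rw [AlgEquiv.apply_symm_apply, ← h1, AlgEquiv.apply_symm_apply, AlgEquiv.apply_symm_apply]
  have hcc : ∀ b : L ≃ₐ[k] L, c (c b) = b := by
    intro b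
    apply AlgEquiv.ext
    intro x
    simp only [hcdef, conjRestrictHom_apply, conjRestrict_apply]
    rw [h1, h2]
    have := congrArg (fun g : L ≃ₐ[k] L => g (a₀.symm x)) (hcommA a₀ b)
    simpa using this
  -- KEY: an element fixed by `c` is trivial (else `Gal(L/ℚ)` is abelian and `K/ℚ` Galois)
  have hfix : ∀ b : L ≃ₐ[k] L, c b = b → b = 1 := by
    intro b hb
    by_contra hb1
    -- `c = id`, since `b` generates
    have hcid : ∀ a' : L ≃ₐ[k] L, c a' = a' := by
      intro a'
      have ha' : a' ∈ Subgroup.zpowers b := mem_zpowers_of_prime_card hc3 hb1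
      obtain ⟨m, rfl⟩ := Subgroup.mem_zpowers_iff.mp ha'
      rw [map_zpow, hb]
    -- notation: `r a' = a'` viewed in `Gal(L/ℚ)`
    set r : (L ≃ₐ[k] L) → (L ≃ₐ[ℚ] L) := fun a' => a'.restrictScalars ℚ with hrdef
    have hrτ : ∀ a', τ * r a' = r a' * τ := by
      intro a'
      have h := AlgEquiv.restrictScalars_conjRestrict τ a'
      rw [show conjRestrict τ a' = a' from hcid a'] at h
      -- `h : r a' = τ * r a' * τ⁻¹`
      calc τ * r a' = τ * r a' * τ⁻¹ * τ := by rw [inv_mul_cancel_right]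
        _ = r a' * τ := by rw [← h]
    have hrr : ∀ a' b', r a' * r b' = r b' * r a' := by
      intro a' b'
      apply AlgEquiv.ext
      intro x
      have := congrArg (fun g : L ≃ₐ[k] L => g x) (hcommA a' b')
      simpa [hrdef, AlgEquiv.mul_apply] using this
    -- every element of `Gal(L/ℚ)` is `r a'` or `τ * r a'`
    have hdec : ∀ σ : L ≃ₐ[ℚ] L, ∃ a', σ = r a' ∨ σ = τ * r a' := by
      intro σ
      by_cases hσ : σ.restrictNormal k = 1
      · obtain ⟨a', ha'⟩ := exists_restrictScalars_eq_of_restrictNormal_eq_one L hσ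
        exact ⟨a', Or.inl ha'.symm⟩
      · have heq : σ.restrictNormal k = τ.restrictNormal k := by
          obtain ⟨y, -, hy⟩ := (Nat.card_eq_two_iff' (1 : k ≃ₐ[ℚ] k)).mp hcard2
          rw [hy _ hσ, hy _ hτ]
        have h1' : (τ⁻¹ * σ).restrictNormal k = 1 := by
          change AlgEquiv.restrictNormalHom k (τ⁻¹ * σ) = 1
          rw [map_mul, map_inv]
          change (τ.restrictNormal k)⁻¹ * σ.restrictNormal k = 1
          rw [heq, inv_mul_cancel]
        obtain ⟨a', ha'⟩ := exists_restrictScalars_eq_of_restrictNormal_eq_one L h1'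
        refine ⟨a', Or.inr ?_⟩
        rw [show r a' = τ⁻¹ * σ from ha', mul_inv_cancel_left]
    -- hence `Gal(L/ℚ)` is commutative
    have hkey : ∀ a' b', τ * r a' * (τ * r b') = τ * τ * (r a' * r b') := fun a' b' => by
      calc τ * r a' * (τ * r b') = τ * (r a' * (τ * r b')) := mul_assoc _ _ _
        _ = τ * ((r a' * τ) * r b') := by rw [← mul_assoc (r a') τ (r b')]
        _ = τ * ((τ * r a') * r b') := by rw [← hrτ a']
        _ = τ * τ * (r a' * r b') := by rw [mul_assoc τ (r a') (r b'), ← mul_assoc τ τ]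
    have hcommG : ∀ σ₁ σ₂ : L ≃ₐ[ℚ] L, σ₁ * σ₂ = σ₂ * σ₁ := by
      intro σ₁ σ₂
      obtain ⟨a₁, h₁ | h₁⟩ := hdec σ₁ <;> obtain ⟨a₂, h₂ | h₂⟩ := hdec σ₂ <;> rw [h₁, h₂]
      · exact hrr a₁ a₂
      · calc r a₁ * (τ * r a₂) = (r a₁ * τ) * r a₂ := (mul_assoc _ _ _).symm
          _ = (τ * r a₁) * r a₂ := by rw [hrτ a₁]
          _ = τ * (r a₁ * r a₂) := mul_assoc _ _ _
          _ = τ * (r a₂ * r a₁) := by rw [hrr a₁ a₂]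
          _ = τ * r a₂ * r a₁ := (mul_assoc _ _ _).symm
      · calc τ * r a₁ * r a₂ = τ * (r a₁ * r a₂) := mul_assoc _ _ _
          _ = τ * (r a₂ * r a₁) := by rw [hrr]
          _ = (τ * r a₂) * r a₁ := (mul_assoc _ _ _).symm
          _ = (r a₂ * τ) * r a₁ := by rw [hrτ a₂]
          _ = r a₂ * (τ * r a₁) := mul_assoc _ _ _
      · rw [hkey, hkey, hrr]
    -- so the subgroup fixing `ι(K)` is normal and `K/ℚ` is Galois
    haveI hN : (ι.fieldRange.fixingSubgroup).Normal :=
      ⟨fun n hn g => by rwa [hcommG g n, mul_inv_cancel_right]⟩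
    have hGal : IsGalois ℚ ι.fieldRange := by
      rw [← IsGalois.fixedField_fixingSubgroup ι.fieldRange]
      exact IsGalois.of_fixedField_normal_subgroup (ι.fieldRange.fixingSubgroup)
    have e : ι.fieldRange ≃ₐ[ℚ] K := (AlgEquiv.ofInjectiveField ι).symm
    exact hKG (IsGalois.of_algEquiv e)
  -- conclusion: `a · c(a)` is fixed by `c`
  have hprod : c (a * c a) = a * c a := by
    rw [map_mul, hcc, hcommA]
  have h1' := hfix _ hprod
  -- `a * c a = 1 ⇒ c a = a⁻¹`
  have : c a = a⁻¹ := eq_inv_of_mul_eq_one_right h1'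
  simpa [hcdef] using this

/-- **Elements of `Gal(L/ℚ)` outside `Gal(L/k)` are involutions** (the `S₃`-structure again): with the
hypotheses of `conjRestrict_eq_inv`, `τ² = 1` for every `τ` non-trivial on `k` (`τ²` lies in `Gal(L/k)`
and is inverted by `τ`, i.e. `τ² = τ⁻²`, so `τ⁴ = 1 = τ⁶`). [cite: DavenportHeilbronn1971, §6 (Gal(K₆/ℚ) = S₃)] -/
theorem sq_eq_one_of_restrictNormal_ne_one (hk : finrank ℚ k = 2) (h3 : finrank k L = 3)
    {K : Type*} [Field K] [Algebra ℚ K] (hKG : ¬ IsGalois ℚ K) (ι : K →ₐ[ℚ] L)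
    {τ : L ≃ₐ[ℚ] L} (hτ : τ.restrictNormal k ≠ 1) : τ ^ 2 = 1 := by
  classical
  haveI : Fact (Nat.Prime 3) := ⟨Nat.prime_three⟩
  haveI : IsGalois k L := by
    haveI : Normal k L := Normal.tower_top_of_normal ℚ k L
    haveI : Algebra.IsSeparable k L := Algebra.IsAlgebraic.isSeparable_of_perfectField
    exact IsGalois.mk
  have hc3 : Nat.card (L ≃ₐ[k] L) = 3 := by rw [IsGalois.card_aut_eq_finrank, h3]
  have hcard2 : Nat.card (k ≃ₐ[ℚ] k) = 2 := by rw [IsGalois.card_aut_eq_finrank, hk]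
  have hτ2 : (τ ^ 2).restrictNormal k = 1 := by
    change AlgEquiv.restrictNormalHom k (τ ^ 2) = 1
    rw [map_pow, ← hcard2]
    exact pow_card_eq_one'
  obtain ⟨a₀, ha₀⟩ := exists_restrictScalars_eq_of_restrictNormal_eq_one L hτ2
  -- `τ a₀ τ⁻¹ = a₀` (as `a₀ = τ²` commutes with `τ`) and `= a₀⁻¹`
  have hconj : conjRestrict τ a₀ = a₀ := by
    apply AlgEquiv.ext
    intro x
    rw [conjRestrict_apply]
    have h1 : ∀ y : L, a₀ y = τ (τ y) := fun y => by
      rw [← AlgEquiv.mul_apply, ← sq, ← ha₀]; rfl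
    rw [h1, h1, AlgEquiv.apply_symm_apply]
  have hinv : a₀ = a₀⁻¹ := hconj.symm.trans (conjRestrict_eq_inv L hk h3 hKG ι hτ a₀)
  -- `a₀² = 1` and `a₀³ = 1` ⇒ `a₀ = 1`
  have ha1 : a₀ = 1 := by
    have hsq : a₀ * a₀ = 1 := by
      nth_rewrite 1 [hinv]
      exact inv_mul_cancel a₀
    have hcube : a₀ ^ 3 = 1 := by rw [← hc3]; exact pow_card_eq_one'
    rwa [pow_succ, pow_two, hsq, one_mul] at hcube
  rw [← ha₀, ha1]
  rfl

end Dihedral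

end Literature.NumberTheory.CubicFields

end
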